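import Literature.Analysis.FluidPDE.SereginZajaczkowski2007SwirlEquationProofs
import Literature.Analysis.FluidPDE.SereginZajaczkowski2007Swirl
import HarnessLib

/-!
# Seregin–Zajaczkowski 2007, proof of Lemma 4.3: time regularity of the swirl for the `L⁴`-energy method

G. Seregin, W. Zajaczkowski, *A sufficient condition of regularity for axially symmetric
solutions to the Navier–Stokes equations*, SIAM J. Math. Anal. 39 (2007) 669–685 =
arXiv:math/0702720, §4, proof of Lemma 4.3 (arXiv numbering). The only leaf of the tree's cone
under Corollary 4.4 (`OffAxisL6Bound`, and through it Prop. 4.1 `OffAxisSupBound` and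
Seregin–Šverák 2009, Prop. 3.7 `SereginSverak2009.AxisDecayBound`, see
`SereginSverakOffAxisLeaves.lean`) that is not yet a theorem is the `L⁴`-energy bound (4.18),
the named fact `SwirlL4EnergyBound` (`SereginZajaczkowski2007Swirl.lean`). Its printed proof is
the energy method for `α̃ = ψ ϱ V_φ`: "we multiply the latter identity by `α̃|α̃|²` and integrate
the product by parts over `𝒞̃₁`" — the identity (4.16) — which needs a genuine TIME DERIVATIVE of
the swirl `α = ϱ V_φ`, whereas the hypothesis class of Prop. 4.1
(`IsSmoothAxisymmetricSolutionOn Q̃ V P`) records no time regularity at all.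

This proofs-only file supplies that first step from the already discharged swirl equation (4.15)
(`SwirlEquation_holds`, time-integrated pointwise form, `SereginZajaczkowski2007SwirlEquationProofs.lean`):

* `hasDerivAt_of_sub_eq_intervalIntegral`: a function whose increments are the integrals of a
  continuous `F` is differentiable with derivative `F` (fundamental theorem of calculus);
* `hasDerivAt_swirl`: for the class, at every `x ∈ 𝒞̃ = 𝒞(1/4, 3; 2)` and `-2² < t < 0`,
  `t ↦ α(t, x) = swirl (V t) x` has the derivative `Δα − Dα[V] − (2/ϱ) ∂_ϱ α` (so (4.15) holds
  with a classical `∂ₜ`), and this derivative is continuous on `Q̃` (`continuousOn_swirlOperator`);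
* `hasDerivAt_cutoff_slice`, `hasDerivAt_alphaTilde`, `hasDerivAt_alphaTilde_pow_four`,
  `betaTilde_sq_eq_alphaTilde_pow_four`: the time derivatives of `ψ(·, x)`, of `α̃ = ψ α`
  (`alphaTilde`) and of `α̃⁴ = β̃²` (`betaTilde`), i.e. the density `∂ₜ(α̃⁴) = 4 α̃³ (∂ₜψ α + ψ ∂ₜα)`
  whose space integral is `∂ₜ ∫_{𝒞̃₁} |α̃|⁴ dx` in (4.16).

## Plan for `SwirlL4EnergyBound_holds` (review of 2026-08-15; every input named below is accepted)

Notation: `ψ` with `IsSwirlCutoff ψ` (spatial support in a compact `K₀ ⊆ 𝒞̃₁ = shell (5/16) (11/4) (7/4)`,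
`ψ(t, ·) = 0` for `t ≤ t₀`, `t₀ > -(7/4)²`); `Y(t) = ∫ α̃⁴ = ∫_{𝒞̃₁} β̃²`,
`D(t) = ∫ Σᵢ (∂ᵢβ̃)² ≥ ∫ ‖D β̃(t,·)‖²` (`norm_sq_le_frobeniusNormSq`); `K ≥ 𝒜₂`, so
`∫_𝒞̃ |V(t)|² ≤ K` for every `t` (`IsSmoothAxisymmetricSolutionOn.setLIntegral_sq_le`) and
`G(t) = ∫_𝒞̃ |∇V(t)|²` has `∫ G dt ≤ K`.
1. (4.16), Cartesian: with `F = ∂ₜα` from `hasDerivAt_swirl`,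
   `ψF = [Δα̃ − 2⟪∇ψ,∇α⟫ − αΔψ] − [Dα̃[V] − αDψ[V]] − (2/ϱ)[Dα̃[e_ϱ] − αDψ[e_ϱ]]`; three
   integrations by parts without boundary terms (`integral_mul_fderiv_apply_eq_neg_of_tsupport_subset`,
   `laplacian_eq_sum_of_contDiffAt`, `SereginZajaczkowski2007L42VorticityEnergy.lean`) give
   `∫ α̃³Δα̃ = −3∫ α̃²|∇α̃|² = −(3/4)D`, `∫ α̃³Dα̃[V] = −¼∫ (div V) α̃⁴ = 0`
   (`IsSmoothAxisymmetricSolutionOn.divergence_eq_zero`), `∫ (2/ϱ)α̃³Dα̃[e_ϱ] = −½∫ α̃⁴ div(x_h/ϱ²) = 0`;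
   hence `¼Y' + ¾D = ∫ α̃³α(∂ₜψ + Dψ[V] + (2/ϱ)Dψ[e_ϱ]) − ∫ α̃³(2⟪∇ψ,∇α⟫ + αΔψ)` (= `J₁ + J₂`).
   (Do the Laplacian integration by parts on the full `α̃`: expanding `∫ψ⁴α³Δα` instead leaves
   `12∫ψ²α⁴|∇ψ|²`, which does not close.)
2. Pointwise: `|α| ≤ 3|V|`, `‖∇α‖ ≤ c(|V| + ‖DV‖)` (`hasFDerivAt_swirl`), so
   `∫_{K₀}(|α| + ‖∇α‖)² ≤ c(K + G)`; `ψ(t,·)` axially symmetric ⇒ `Dψ[Jx] = 0` ⇒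
   `|Dψ[V]| ≤ ‖Dψ‖ · |V^a|` (`|V^a| = poloidalSpeed`, `norm_sq_eq_poloidalSpeed_sq_add_swirlVelocity_sq`).
   So `¼Y' + ¾D ≤ M∫|α̃|³|α||V^a| + C_ψ∫_{K₀}|α̃|³(|α| + ‖∇α‖) = E₁ + E₂`.
3. With (4.17) for the slices (`setLIntegral_betaTilde_rpow_le`: `∫β̃^{10/3} ≤ c Y^{2/3} D`) and
   Lemma 4.2 at `q = 20` (`OffAxisPoloidalBound_holds`: `∫_{𝒞̃₁}|V^a(t)|^{20} ≤ Φ₁ 20 K`; `q = 20`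
   instead of the printed `q = 4` removes the Gagliardo–Nirenberg step for `α`):
   `E₁ ≤ 3MK^{1/2}(∫β̃³|V^a|²)^{1/2}` (Cauchy–Schwarz), `∫β̃³|V^a|² ≤ (∫β̃^{10/3})^{9/10}(Φ₁ 20 K)^{1/10}`
   (`ENNReal.lintegral_mul_le_Lp_mul_Lq`, exponents `10/9, 10`), whence
   `E₁ ≤ δD + C(1+K)(1+Φ₁ 20 K)(1+Y)`; and `β̃³ ≤ β̃² + β̃^{10/3}` gives
   `E₂ ≤ C_ψ(Y + cY^{2/3}D)^{1/2}(c(K+G))^{1/2} ≤ δD + C(1+K+G)(1+Y)` (Young with squares). So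
   `Y' + D ≤ k(t)(1+Y)`, `k = C_*(1+K)(1+Φ₁ 20 K)(1+G(t))`, for every `t` with `G(t) < ∞`.
4. `Y(t) = ∫_{t₀}^{t} Y'` (this file + Fubini, pattern `integral_uFun_sq_eq`), `Y` bounded on
   `[t₀, T]`, Grönwall (`lintegral_gronwall_le_of_Icc`): `1 + Y ≤ exp(∫k) ≤ exp(L K)`,
   `L K = C_*(1+K)(1+Φ₁ 20 K)(4+K)`, then `∫D ≤ (L K) exp(L K)`; Tonelli identifies
   `∫_{Q̃₁}‖Dβ̃‖²` with `∫ (∫‖Dβ̃(t)‖²) dt ≤ ∫ D`. `Φ₅ K = exp(L K)(1 + L K)`, monotone. Then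
   `OffAxisL6Bound_holds := offAxisL6Bound_of_swirlL4EnergyBound SwirlL4EnergyBound_holds`.

## References

* G. Seregin, W. Zajaczkowski, SIAM J. Math. Anal. 39 (2007) 669–685, arXiv:math/0702720, §4,
  proof of Lemma 4.3: (4.15), (4.16), (4.17), (4.18). [`SereginZajaczkowski2007`]
-/

noncomputable section

open MeasureTheory Set Function Filter Topology TopologicalSpace Metric WithLp
open scoped NNReal ENNReal ContDiff InnerProductSpace RealInnerProductSpace Laplacian

namespace Literature.Analysis.FluidPDE

namespace SereginZajaczkowski2007

open SereginSverak2009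

/-! ### The fundamental theorem of calculus, in the form the swirl equation is stated -/

/-- **From increments to a derivative.** If `F` is continuous on the open interval `]lo, hi[` and
`a r - a s = ∫ₛʳ F` whenever `lo < s ≤ r < hi`, then `a` has the derivative `F t` at every
`t ∈ ]lo, hi[` (fundamental theorem of calculus, Mathlib's
`intervalIntegral.integral_hasDerivAt_right`). [folklore] -/
theorem hasDerivAt_of_sub_eq_intervalIntegral {a F : ℝ → ℝ} {lo hi t : ℝ} (ht : t ∈ Ioo lo hi)
    (hF : ContinuousOn F (Ioo lo hi))
    (h : ∀ s r : ℝ, lo < s → s ≤ r → r < hi → a r - a s = ∫ u in s..r, F u) :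
    HasDerivAt a (F t) t := by
  obtain ⟨s₀, hs₀, hs₀t⟩ : ∃ s₀, lo < s₀ ∧ s₀ < t :=
    ⟨(lo + t) / 2, by linarith [ht.1], by linarith [ht.1]⟩
  have hint : IntervalIntegrable F volume s₀ t :=
    (hF.mono (Icc_subset_Ioo hs₀ ht.2)).intervalIntegrable_of_Icc hs₀t.le
  have hmeas : StronglyMeasurableAtFilter F (𝓝 t) :=
    hF.stronglyMeasurableAtFilter isOpen_Ioo t ht
  have hcont : ContinuousAt F t := hF.continuousAt (isOpen_Ioo.mem_nhds ht)
  have hD : HasDerivAt (fun r => a s₀ + ∫ u in s₀..r, F u) (F t) t :=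
    (intervalIntegral.integral_hasDerivAt_right hint hmeas hcont).const_add (a s₀)
  refine hD.congr_of_eventuallyEq ?_
  filter_upwards [isOpen_Ioo.mem_nhds (show t ∈ Ioo s₀ hi from ⟨hs₀t, ht.2⟩)] with r hr
  have h1 := h s₀ r hs₀ hr.1.le hr.2
  linarith

/-! ### The swirl has a classical, continuous time derivative -/

section Swirl

variable {V : ℝ → (EuclideanSpace ℝ (Fin 3)) → (EuclideanSpace ℝ (Fin 3))} {P : ℝ → (EuclideanSpace ℝ (Fin 3)) → ℝ}

/-- The right-hand side `Δα − Dα[V] − (2/ϱ)∂_ϱα` of the swirl equation, at a fixed point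
`x ∈ 𝒞̃`, is continuous in time on `]-2², 0[` (slice of `continuousOn_swirlOperator`).
[folklore] -/
theorem continuousOn_swirlOperator_slice
    (hV : IsSmoothAxisymmetricSolutionOn (shellCylOpens (1 / 4) 3 2 2) V P) {x : (EuclideanSpace ℝ (Fin 3))}
    (hx : x ∈ shell (1 / 4) 3 2) :
    ContinuousOn (fun r : ℝ => (Δ (swirl (V r))) x - fderiv ℝ (swirl (V r)) x (V r x) -
      2 / cylRadius x * partialDeriv (eR x) (swirl (V r)) x) (Ioo (-2 ^ 2) 0) := by
  have hmk : Continuous fun r : ℝ => ((r, x) : ℝ × (EuclideanSpace ℝ (Fin 3))) := continuous_id.prodMk continuous_const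
  have hmaps : MapsTo (fun r : ℝ => ((r, x) : ℝ × (EuclideanSpace ℝ (Fin 3)))) (Ioo (-2 ^ 2) 0)
      ((shellCylOpens (1 / 4) 3 2 2 : Opens (ℝ × (EuclideanSpace ℝ (Fin 3)))) : Set (ℝ × (EuclideanSpace ℝ (Fin 3)))) := by
    intro r hr
    rw [coe_shellCylOpens, mem_shellCyl]
    exact ⟨hr, (mem_shell.1 hx).1, (mem_shell.1 hx).2⟩
  have h := (continuousOn_swirlOperator hV).comp hmk.continuousOn hmaps
  exact h

/-- **The swirl equation (4.15) with a classical time derivative.** For the class of Prop. 4.1 on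
`Q̃ = 𝒞(1/4, 3; 2) × ]-2², 0[`, at every `x ∈ 𝒞̃` and `-2² < t < 0` the function
`t ↦ α(t, x) = swirl (V t) x` (`= ϱ V_φ`) is differentiable with
`∂ₜα = Δα − Dα[V] − (2/ϱ) ∂_ϱα` (from the discharged time-integrated form `SwirlEquation_holds`
and the continuity of the right-hand side, `continuousOn_swirlOperator`).
[cite: SereginZajaczkowski2007, proof of Lemma 4.3, (4.15)] -/
theorem hasDerivAt_swirl (hV : IsSmoothAxisymmetricSolutionOn (shellCylOpens (1 / 4) 3 2 2) V P)
    {x : (EuclideanSpace ℝ (Fin 3))} (hx : x ∈ shell (1 / 4) 3 2) {t : ℝ} (ht : t ∈ Ioo (-2 ^ 2 : ℝ) 0) :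
    HasDerivAt (fun r => swirl (V r) x)
      ((Δ (swirl (V t))) x - fderiv ℝ (swirl (V t)) x (V t x) -
        2 / cylRadius x * partialDeriv (eR x) (swirl (V t)) x) t :=
  hasDerivAt_of_sub_eq_intervalIntegral (a := fun r => swirl (V r) x)
    (F := fun r => (Δ (swirl (V r))) x - fderiv ℝ (swirl (V r)) x (V r x) -
      2 / cylRadius x * partialDeriv (eR x) (swirl (V r)) x)
    ht (continuousOn_swirlOperator_slice hV hx) (SwirlEquation_holds V P hV x hx)

/-- The time derivative of the swirl, `deriv (α(·, x)) t = Δα − Dα[V] − (2/ϱ)∂_ϱα`.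
[cite: SereginZajaczkowski2007, proof of Lemma 4.3, (4.15)] -/
theorem deriv_swirl (hV : IsSmoothAxisymmetricSolutionOn (shellCylOpens (1 / 4) 3 2 2) V P)
    {x : (EuclideanSpace ℝ (Fin 3))} (hx : x ∈ shell (1 / 4) 3 2) {t : ℝ} (ht : t ∈ Ioo (-2 ^ 2 : ℝ) 0) :
    deriv (fun r => swirl (V r) x) t =
      (Δ (swirl (V t))) x - fderiv ℝ (swirl (V t)) x (V t x) -
        2 / cylRadius x * partialDeriv (eR x) (swirl (V t)) x :=
  (hasDerivAt_swirl hV hx ht).deriv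

/-- The swirl is continuously differentiable in time on `Q̃`: its time derivative (the accepted
`timeDeriv`) is continuous on `Q̃` in space–time. [folklore] -/
theorem continuousOn_timeDeriv_swirl
    (hV : IsSmoothAxisymmetricSolutionOn (shellCylOpens (1 / 4) 3 2 2) V P) :
    ContinuousOn (fun z : ℝ × (EuclideanSpace ℝ (Fin 3)) => timeDeriv (fun t y => swirl (V t) y) z.1 z.2)
      ((shellCylOpens (1 / 4) 3 2 2 : Opens (ℝ × (EuclideanSpace ℝ (Fin 3)))) : Set (ℝ × (EuclideanSpace ℝ (Fin 3)))) := by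
  refine (continuousOn_swirlOperator hV).congr fun z hz => ?_
  exact deriv_swirl hV hz.2 hz.1

end Swirl

/-! ### Time derivatives of the cut-off quantities `α̃`, `α̃⁴ = β̃²` -/

section Cutoff

variable {ψ : ℝ × (EuclideanSpace ℝ (Fin 3)) → ℝ} {V : ℝ → (EuclideanSpace ℝ (Fin 3)) → (EuclideanSpace ℝ (Fin 3))} {P : ℝ → (EuclideanSpace ℝ (Fin 3)) → ℝ}

/-- The time derivative of the slice `t ↦ ψ(t, x)` of a smooth function of space–time is
`Dψ(t, x)[(1, 0)]`. [folklore] -/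
theorem hasDerivAt_cutoff_slice (hψ : ContDiff ℝ ∞ ψ) (t : ℝ) (x : (EuclideanSpace ℝ (Fin 3))) :
    HasDerivAt (fun r => ψ (r, x)) (fderiv ℝ ψ (t, x) ((1 : ℝ), (0 : (EuclideanSpace ℝ (Fin 3))))) t := by
  have h1 : HasFDerivAt ψ (fderiv ℝ ψ (t, x)) (t, x) :=
    ((hψ.differentiable (by simp)) (t, x)).hasFDerivAt
  have h2 : HasDerivAt (fun r : ℝ => ((r, x) : ℝ × (EuclideanSpace ℝ (Fin 3)))) ((1 : ℝ), (0 : (EuclideanSpace ℝ (Fin 3)))) t :=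
    (hasDerivAt_id t).prodMk (hasDerivAt_const t x)
  exact h1.comp_hasDerivAt t h2

/-- The time derivative `∂ₜψ(t, x) = Dψ(t, x)[(1, 0)]` is continuous in space–time. [folklore] -/
theorem continuous_cutoff_timeDeriv (hψ : ContDiff ℝ ∞ ψ) :
    Continuous fun z : ℝ × (EuclideanSpace ℝ (Fin 3)) => fderiv ℝ ψ z ((1 : ℝ), (0 : (EuclideanSpace ℝ (Fin 3)))) :=
  (hψ.continuous_fderiv (by simp)).clm_apply continuous_const

/-- **Time derivative of `α̃ = ψ α`** (`alphaTilde`): at `x ∈ 𝒞̃`, `-2² < t < 0`,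
`∂ₜα̃ = ∂ₜψ · α + ψ · ∂ₜα` with `∂ₜα = Δα − Dα[V] − (2/ϱ)∂_ϱα` (`hasDerivAt_swirl`).
[cite: SereginZajaczkowski2007, proof of Lemma 4.3 (the identity for α̃)] -/
theorem hasDerivAt_alphaTilde (hψ : ContDiff ℝ ∞ ψ)
    (hV : IsSmoothAxisymmetricSolutionOn (shellCylOpens (1 / 4) 3 2 2) V P)
    {x : (EuclideanSpace ℝ (Fin 3))} (hx : x ∈ shell (1 / 4) 3 2) {t : ℝ} (ht : t ∈ Ioo (-2 ^ 2 : ℝ) 0) :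
    HasDerivAt (fun r => alphaTilde ψ V r x)
      (fderiv ℝ ψ (t, x) ((1 : ℝ), (0 : (EuclideanSpace ℝ (Fin 3)))) * swirl (V t) x +
        ψ (t, x) * ((Δ (swirl (V t))) x - fderiv ℝ (swirl (V t)) x (V t x) -
          2 / cylRadius x * partialDeriv (eR x) (swirl (V t)) x)) t :=
  (hasDerivAt_cutoff_slice hψ t x).mul (hasDerivAt_swirl hV hx ht)

/-- `β̃² = α̃⁴` (`β̃ = α̃²`). [folklore] -/
theorem betaTilde_sq_eq_alphaTilde_pow_four (ψ : ℝ × (EuclideanSpace ℝ (Fin 3)) → ℝ) (V : ℝ → (EuclideanSpace ℝ (Fin 3)) → (EuclideanSpace ℝ (Fin 3))) (t : ℝ)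
    (x : (EuclideanSpace ℝ (Fin 3))) : betaTilde ψ V t x ^ 2 = alphaTilde ψ V t x ^ 4 := by
  rw [betaTilde]
  ring

/-- **Time derivative of `|α̃|⁴`**, the density of `¼ ∂ₜ ∫ |α̃|⁴ dx` in the energy identity
(4.16): `∂ₜ(α̃⁴) = 4 α̃³ (∂ₜψ · α + ψ · ∂ₜα)` at `x ∈ 𝒞̃`, `-2² < t < 0`.
[cite: SereginZajaczkowski2007, proof of Lemma 4.3, (4.16)] -/
theorem hasDerivAt_alphaTilde_pow_four (hψ : ContDiff ℝ ∞ ψ)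
    (hV : IsSmoothAxisymmetricSolutionOn (shellCylOpens (1 / 4) 3 2 2) V P)
    {x : (EuclideanSpace ℝ (Fin 3))} (hx : x ∈ shell (1 / 4) 3 2) {t : ℝ} (ht : t ∈ Ioo (-2 ^ 2 : ℝ) 0) :
    HasDerivAt (fun r => alphaTilde ψ V r x ^ 4)
      (4 * alphaTilde ψ V t x ^ 3 *
        (fderiv ℝ ψ (t, x) ((1 : ℝ), (0 : (EuclideanSpace ℝ (Fin 3)))) * swirl (V t) x +
          ψ (t, x) * ((Δ (swirl (V t))) x - fderiv ℝ (swirl (V t)) x (V t x) -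
            2 / cylRadius x * partialDeriv (eR x) (swirl (V t)) x))) t := by
  have h := (hasDerivAt_alphaTilde hψ hV hx ht).fun_pow 4
  refine h.congr_deriv ?_
  norm_num

/-- **Time derivative of `β̃²`** (`betaTilde`), the same density written for `β̃ = α̃²`:
`∂ₜ(β̃²) = 4 α̃³ (∂ₜψ · α + ψ · ∂ₜα)`. [cite: SereginZajaczkowski2007, proof of Lemma 4.3, (4.16)] -/
theorem hasDerivAt_betaTilde_sq (hψ : ContDiff ℝ ∞ ψ)
    (hV : IsSmoothAxisymmetricSolutionOn (shellCylOpens (1 / 4) 3 2 2) V P)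
    {x : (EuclideanSpace ℝ (Fin 3))} (hx : x ∈ shell (1 / 4) 3 2) {t : ℝ} (ht : t ∈ Ioo (-2 ^ 2 : ℝ) 0) :
    HasDerivAt (fun r => betaTilde ψ V r x ^ 2)
      (4 * alphaTilde ψ V t x ^ 3 *
        (fderiv ℝ ψ (t, x) ((1 : ℝ), (0 : (EuclideanSpace ℝ (Fin 3)))) * swirl (V t) x +
          ψ (t, x) * ((Δ (swirl (V t))) x - fderiv ℝ (swirl (V t)) x (V t x) -
            2 / cylRadius x * partialDeriv (eR x) (swirl (V t)) x))) t := by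
  have h := hasDerivAt_alphaTilde_pow_four hψ hV hx ht
  have heq : (fun r => betaTilde ψ V r x ^ 2) = fun r => alphaTilde ψ V r x ^ 4 :=
    funext fun r => betaTilde_sq_eq_alphaTilde_pow_four ψ V r x
  rw [heq]
  exact h

/-- **The density `∂ₜ(α̃⁴)` is continuous on `Q̃`** in space–time (so that `t ↦ ∫ α̃⁴ dx` can be
differentiated under the integral sign, or recovered from its derivative by Fubini, in (4.16)).
[folklore] -/
theorem continuousOn_alphaTilde_pow_four_timeDeriv (hψ : ContDiff ℝ ∞ ψ)
    (hV : IsSmoothAxisymmetricSolutionOn (shellCylOpens (1 / 4) 3 2 2) V P) :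
    ContinuousOn (fun z : ℝ × (EuclideanSpace ℝ (Fin 3)) => 4 * alphaTilde ψ V z.1 z.2 ^ 3 *
        (fderiv ℝ ψ z ((1 : ℝ), (0 : (EuclideanSpace ℝ (Fin 3)))) * swirl (V z.1) z.2 +
          ψ z * ((Δ (swirl (V z.1))) z.2 - fderiv ℝ (swirl (V z.1)) z.2 (V z.1 z.2) -
            2 / cylRadius z.2 * partialDeriv (eR z.2) (swirl (V z.1)) z.2)))
      ((shellCylOpens (1 / 4) 3 2 2 : Opens (ℝ × (EuclideanSpace ℝ (Fin 3)))) : Set (ℝ × (EuclideanSpace ℝ (Fin 3)))) := by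
  have hsw : ContinuousOn (fun z : ℝ × (EuclideanSpace ℝ (Fin 3)) => swirl (V z.1) z.2)
      ((shellCylOpens (1 / 4) 3 2 2 : Opens (ℝ × (EuclideanSpace ℝ (Fin 3)))) : Set (ℝ × (EuclideanSpace ℝ (Fin 3)))) := hV.continuousOn_swirl
  have hψc : Continuous ψ := hψ.continuous
  have hα : ContinuousOn (fun z : ℝ × (EuclideanSpace ℝ (Fin 3)) => alphaTilde ψ V z.1 z.2)
      ((shellCylOpens (1 / 4) 3 2 2 : Opens (ℝ × (EuclideanSpace ℝ (Fin 3)))) : Set (ℝ × (EuclideanSpace ℝ (Fin 3)))) := by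
    have h : ContinuousOn (fun z : ℝ × (EuclideanSpace ℝ (Fin 3)) => ψ z * swirl (V z.1) z.2)
        ((shellCylOpens (1 / 4) 3 2 2 : Opens (ℝ × (EuclideanSpace ℝ (Fin 3)))) : Set (ℝ × (EuclideanSpace ℝ (Fin 3)))) :=
      hψc.continuousOn.mul hsw
    refine h.congr fun z _ => ?_
    simp only [alphaTilde, Prod.mk.eta]
  refine (continuousOn_const.mul (hα.pow 3)).mul ?_
  refine ((continuous_cutoff_timeDeriv hψ).continuousOn.mul hsw).add ?_
  exact hψc.continuousOn.mul (continuousOn_swirlOperator hV)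

/-- The time derivative of `t ↦ ∫ α̃⁴`-density vanishes where the cut-off slice vanishes to second
order in time, in particular before the cut-off is switched on: if `ψ(s, x) = 0` for all `s ≤ t₀`
then `∂ₜ(α̃⁴)(t, x) = 0` for `t < t₀`. [folklore] -/
theorem hasDerivAt_alphaTilde_pow_four_of_lt {t₀ t : ℝ} (h0 : ∀ s ≤ t₀, ∀ y : (EuclideanSpace ℝ (Fin 3)), ψ (s, y) = 0)
    (ht : t < t₀) (V : ℝ → (EuclideanSpace ℝ (Fin 3)) → (EuclideanSpace ℝ (Fin 3))) (x : (EuclideanSpace ℝ (Fin 3))) :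
    HasDerivAt (fun r => alphaTilde ψ V r x ^ 4) 0 t := by
  have hev : (fun r => alphaTilde ψ V r x ^ 4) =ᶠ[𝓝 t] fun _ => 0 := by
    filter_upwards [Iio_mem_nhds ht] with r hr
    simp [alphaTilde, h0 r (le_of_lt hr) x]
  exact (hasDerivAt_const t (0 : ℝ)).congr_of_eventuallyEq hev

end Cutoff

end SereginZajaczkowski2007

end Literature.Analysis.FluidPDE

end
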